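import Summits.QuantumFields.YangMills.Theorems.BalabanUVNodesN22WindowedNE9OutputLevel
import Summits.QuantumFields.YangMills.Theorems.BalabanUVNodesN22W1StripOnDomain
import Summits.QuantumFields.YangMills.Theorems.BalabanUVNodesN22WindowedDecayOutputLevel

/-!
# BalabanUVNodes ∕ node N22 = NE9 — THE (β′) LETTER FROM PER-STEP SCHEMAS: this lane's STRIP lineage (node N10's (2.14)–(2.26) read on a common complex domain of ONE
# older coupling + node N09's `EHoloAt` family + Lemma 3's numerals ⟹ OUTPUT-level coupling holomorphy of every (2.13) term in EVERY coupling) junctioned BY NAME into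
# J34's output-level road — the END-TO-END analytic road in kernel currency, successor trigger (t9) of the g11∕g12 census

Cell `pub-ymgap`, HUMAN RULING D-0062 (Track A), R134 seat `pub-ymgap-dag-n22-c` (strategy s1), generation 13, module J35.  THEOREMS ONLY (no `def`, no `sorry`); imports J34
`…Theorems.BalabanUVNodesN22WindowedNE9OutputLevel` (`windowedNE9_localizedSum_of_outputCoordHolo`) and this seat's g4 module 14′ `…Theorems.BalabanUVNodesN22W1StripOnDomain`
(p486819; `stripBound_termC_of_termwise226OnOlder_eHoloAt` — the strip at EVERY level in EVERY coupling at the space tables of record from the older-coupling level-T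
hypothesis `h226TOnOlder` UNIVERSAL IN THE DOMAIN + an `EHoloAt` family + the Lemma-3 socket numerals) — consumed BY NAME.  Filed `--supports stmt-QuantumFields-20544` (K3⁷) as a HELPER.

WHY.  Census g12 (t9) ∕ g13 (t9′): «a junction from the STRIP lineage's generator-schema currency to the kernel road».  With J34 the kernel road's coupling input is
OUTPUT-level coupling holomorphy of the terms on uniform margins — which is EXACTLY what the strip lineage concludes (`∃ Ec O, IsOpen O ∧ D̄(t, r) ⊆ O ∧ holo ∧
‖Ec‖ ≤ E₀e^{−κ d_j(Y)} ∧ Ec t = E^{(j)}(Y; g|g_i := t; ψ)`, every `j, i`, window histories, `ψ ∈ U^c_j(Y, α₀, α₁)`).  So the junction is one prefix-extension + `termC_succ`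
+ `restrictPrefix_update` per datum (§1) and one application of J34 (§2).

WHAT.  §1 `outputCoordHolo_of_stripSchemas` (per torus `K`: the strip lineage's hypotheses ⟹ J34's datum `hL` at `sp := U^c_{k+1}(·, α₀, α₁)`, every level and coordinate,
radius `r_E`, amplitude `E₀`, rate `κ`); §2 ★★★ `windowedNE9_localizedSum_of_stripSchemas` (THE (β′) LETTER `WindowedNE9 F (localizedSum F S emb) ρ bV W δ₁ (C·4E₀∕r_E)` from,
per torus: `h226TOnOlder` (node N10's lane — [II] (2.14)–(2.26) on a common complex domain of one older coupling; DISPLAYED), one `EHoloAt (sfTowerOfRecord …) cs k` per window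
history and step with uniform letters (node N09; DISPLAYED), the socket numerals `Lemma3Numerics c M (½L) …`, `8 ≤ c.L`, S25's clauses at `A := C₃ε₁`, the renewal
`e·9·64·K₀(64,8)²·C₃ε₁ ≤ E₀`; plus J34's term holomorphy through the readings, chart ∕ space clauses at `X`, tails, `δ₀ > 0`, `2κ₀(64,8) ≤ κ_w ≤ κ`).

VERSIONS.  v1 (p615191): §1–§2.  v1.1 (this file): ADDITIVE — one new import (J36 `…N22WindowedDecayOutputLevel`, the value twin of J34), §3 appended after v1's last
declaration (`termBound118_of_stripSchemas`: printed (1.18) `TermBound118` on the window at the space tables of record from the same schemas, by this seat's g2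
`termBound118_of_stripBound`; ★★★ `windowedDecay_localizedSum_of_stripSchemas`: the VALUE letter `WindowedDecay` from the per-step schemas, by J36's
`windowedDecay_localizedSum_of_termBound118`) — BOTH K3⁷ letters (`h9` history-Lipschitz, `hdec` value) now read from the per-step schemas end to end; every v1
declaration byte-identical.

HONEST FRAMING.  Count-neutral by-name junction of LANDED theorems; no estimate of Bałaban's is proved or asserted here.  DISPLAYED with owners: `h226TOnOlder` (node N10's
T-row in generator-schema currency — NOT a printed display; [II] prints (2.14)–(2.26) per term at real couplings, the common complex domain is the cell's complexification
«(or analytic)»), N09's `EHoloAt` families (node N09), the term holomorphy through the complexified readings + readings + tails (NODE A), numerals.  Nothing of Bałaban's is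
constructed; N22 NOT discharged (typed 28∕28 · discharged 5∕27 UNCHANGED); K3⁷ OPEN; NE9 NOT IN PRINT for d = 4; one finite four-torus programme at fixed ε — NOT infinite volume,
NOT OS on ℝ⁴, NOT a mass gap, NOT Clay.  0 `sorry`, 0 `def`, standard axioms.  References (TYPES only): [I] = [Balaban1987RG1] CMP 109 (1987) §1 p. 263, §2 p. 266,
(1.7) p. 261, (1.18), (1.20)–(1.21) p. 264, p. 282, (5.10) p. 293; [II] = [Balaban1988RG2Cluster] CMP 116 (1988) (2.13)–(2.26) pp. 14–17, Lemma 3 (2.38) p. 20,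
(2.39)–(2.41) p. 21.
-/

noncomputable section

open Filter Topology Set Metric
open scoped BigOperators

namespace YMDAG.N22.OutputLevel

open Literature.MathematicalPhysics.QuantumFieldTheory.Balaban1983to89
open Literature.MathematicalPhysics.QuantumFieldTheory.Balaban1983to89.T4Continuum (T4Family)
open Literature.MathematicalPhysics.QuantumFieldTheory.Balaban1983to89.T4OutputRate (Window)
open Literature.MathematicalPhysics.QuantumFieldTheory.Balaban1983to89.TreeLengthTorus (TPt TDom tsys torusTreeLen torusTreeLen_nonneg)
open Literature.MathematicalPhysics.QuantumFieldTheory.Balaban1983to89.B12TreeDecay (K₀ kappa₀ K₀_pos)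
open Literature.MathematicalPhysics.QuantumFieldTheory.Balaban1983to89.B12Decay510 (delta1)
open Literature.MathematicalPhysics.QuantumFieldTheory.Balaban1983to89.B12Decay510Window (K₁)
open Literature.MathematicalPhysics.QuantumFieldTheory.Balaban1983to89.B12Decay510Torus (distCT nearT)
open Literature.MathematicalPhysics.QuantumFieldTheory.Balaban1983to89.B13Lemma3TorusData (TBond)
open Literature.MathematicalPhysics.QuantumFieldTheory.Balaban1983to89.B13Lemma3TorusTerms (terms weight)
open Literature.MathematicalPhysics.QuantumFieldTheory.Balaban1983to89.B13Lemma3TorusSocket (Lemma3Numerics)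
open Literature.MathematicalPhysics.QuantumFieldTheory.Balaban1983to89.B12BetaHolo (EHoloAt)
open Literature.MathematicalPhysics.QuantumFieldTheory.Balaban1983to89.Step (SFConsts)
open Literature.MathematicalPhysics.QuantumFieldTheory.Balaban1983to89.Node00
open Literature.MathematicalPhysics.QuantumFieldTheory.Balaban1983to89.Node00.Sect2 (domSys domCount CPair ofBackgroundC spaceI domSites Setting Residual)
open Literature.MathematicalPhysics.QuantumFieldTheory.Balaban1983to89.Node00.W1
open Literature.MathematicalPhysics.QuantumFieldTheory.Balaban1983to89.Node00.LocalizedSum17 (localizedSum ReadingMaps)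
open Literature.MathematicalPhysics.QuantumFieldTheory.Balaban1983to89.Node00.U3OfKernels (histPrefix histPrefix_apply)
open Literature.MathematicalPhysics.QuantumFieldTheory.Balaban1983to89.Node00.U3KernelLetters (WindowedNE9)
open YMDAG.N22.W1 (restrictPrefix_update stripBound_termC_of_termwise226OnOlder_eHoloAt)

/-! ## §1 The strip lineage's all-coupling term strips ⟹ J34's output-level coupling-holomorphy data on the box prefixes -/

section Step

variable (F : T4Family) (K : ℕ) {𝔸 : Type*} [NormedRing 𝔸] [NormedAlgebra ℂ 𝔸] [CompleteSpace 𝔸] {G : Type*} [GaugeGroup G] {M : ℕ}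
  (Sg : Setting 𝔸 G) (Rz : Residual (F.P K) 𝔸) (logZ : ℕ → GaugeField (F.P K) 0 G → ℝ) (β : ℕ → ℝ → ℝ)

open Classical in
/-- **THE STRIP LINEAGE's OUTPUT, READ AS J34's DATUM.**  Module 14′ §4 `stripBound_termC_of_termwise226OnOlder_eHoloAt` — from node N10's older-coupling level-T hypothesis
`h226TOnOlder` UNIVERSAL IN THE DOMAIN ([II] (2.14)–(2.26) read on a common complex domain of one older coupling), one `EHoloAt (sfTowerOfRecord Sg Rz M S ⟨g, β⟩ logZ) cs k` per
window history and step with uniform letters `(E₀, r_E)` (node N09), the socket numerals and S25's clauses — gives at every level `k` and EVERY coordinate `i ≤ k`, for every box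
prefix `p`, `X ∈ 𝐃_{k+1}` and `φ ∈ U^c_{k+1}(X, cs.α₀, cs.α₁)`: a holomorphic extension of `t ↦ E^{(k+1)}(X; p|p_i := t; φ)` on an open set containing the closed `r_E`-discs
about `]0, γ]`, bounded by `E₀·e^{−κ d_{k+1}(X)}` — the strip at the window history extending `p` by its own `0`-th coupling, `termC_succ`, `restrictPrefix_update`.
[cite: Balaban1988RG2Cluster, (2.14)-(2.26) pp.15-17, Lemma 3 (2.38) p.20 and (2.40)-(2.41) p.21; Balaban1987RG1, §1 p.263, §2 p.266 and (1.18)] -/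
theorem outputCoordHolo_of_stripSchemas [NeZero M] (S : ClusterTower (F.P K) 𝔸 M) (c : B13.Consts) {L : ℕ} [NeZero L]
    (hL : 8 ≤ c.L) (hLc : c.L = L) {a a₂ a₂' a₅ Aabs : ℝ} (hN : Lemma3Numerics c M ((c.L : ℝ) / 2) a a₂ a₂' a₅ Aabs)
    {cs : SFConsts} {γ rE E₀ κ r₁ : ℝ} (hrE : 0 ≤ rE) (hA0 : 0 ≤ c.C3act * c.ε₁) (hr₁ : 0 ≤ r₁) (hκ : κ ≤ r₁)
    (hrate : r₁ + 2 * (64 * Real.log 162) + 2 ≤ (1 - 8 * c.δ) * ((c.L : ℝ) / 2) * c.κ)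
    (hsmall : c.C3act * c.ε₁ * Real.exp (5 * r₁ + 1) * K₀ 64 8 * 9 * 64 ≤ 1)
    (hrenew : Real.exp 1 * 9 * 64 * K₀ 64 8 ^ 2 * (c.C3act * c.ε₁) ≤ E₀) (hγ : γ ≤ cs.γ) (hκc : κ ≤ cs.κ)
    (h226TOnOlder : ∀ (D : Set ℂ), IsOpen D → (∀ t ∈ Ioc (0 : ℝ) γ, closedBall (t : ℂ) rE ⊆ D) →
      ∀ (k : ℕ) (g : ℕ → ℝ), g ∈ Window γ → ∀ (i : ℕ), i < k → ∀ (X : (domSys (F.P K) M (k + 1)).Dom) (φ : CPair (F.P K) 𝔸),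
      φ ∈ spaceI Sg Rz M (k + 1) (domSites (F.P K) M (k + 1) X) cs.α₀ cs.α₁ →
      (∀ (j : ℕ), j < k + 1 → ∀ (Y : (domSys (F.P K) M j).Dom) (ψ : CPair (F.P K) 𝔸), ψ ∈ spaceI Sg Rz M j (domSites (F.P K) M j Y) cs.α₀ cs.α₁ →
        ∃ Ec : ℂ → ℂ, DifferentiableOn ℂ Ec D ∧ (∀ z ∈ D, ‖Ec z‖ ≤ E₀ * Real.exp (-(κ * torusTreeLen Y.1))) ∧
          (∀ t ∈ Ioc (0 : ℝ) γ, Ec t = termC S j Y (Function.update g i t) ψ)) →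
      ∃ (Hc : ℂ → TDom 4 (domCount (F.P K) M (k + 1)) → ℂ)
        (Tt : (Z : TDom 4 (domCount (F.P K) M (k + 1))) →
          Finset (TDom 4 (L * domCount (F.P K) M (k + 1))) × Finset (TBond 4 M (L * domCount (F.P K) M (k + 1))) → ℂ → ℂ),
        (∀ Z : (domSys (F.P K) M (k + 1)).Dom, Z.1 ⊆ X.1 → DifferentiableOn ℂ (fun z => Hc z Z) D) ∧
        (∀ z ∈ D, ∀ Z : TDom 4 (domCount (F.P K) M (k + 1)), Z.1 ⊆ X.1 → ‖Hc z Z‖ ≤ ∑ t ∈ terms L M Z, ‖Tt Z t z‖) ∧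
        (∀ z ∈ D, ∀ Z : TDom 4 (domCount (F.P K) M (k + 1)), Z.1 ⊆ X.1 → ∀ t ∈ terms L M Z,
          ‖Tt Z t z‖ ≤ weight L M c Z a t * Real.exp (a₅ * ((Z.1).card : ℝ))) ∧
        (∀ t ∈ Ioc (0 : ℝ) γ, Hc t = (S k).H (restrictPrefix k (Function.update g i t)) φ))
    (hE : ∀ g ∈ Window γ, ∀ k : ℕ, ∃ H : EHoloAt (sfTowerOfRecord Sg Rz M S ⟨g, β⟩ logZ) cs k, H.E₀ ≤ E₀ ∧ rE ≤ H.r) (k : ℕ) (i : Fin (k + 1)) :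
    ∀ p ∈ box γ k, ∀ (X : (domSys (F.P K) M (k + 1)).Dom), ∀ φ ∈ spaceI Sg Rz M (k + 1) (domSites (F.P K) M (k + 1) X) cs.α₀ cs.α₁,
      ∃ (Ec : ℂ → ℂ) (O : Set ℂ), DifferentiableOn ℂ Ec O ∧ (∀ t ∈ Ioc (0 : ℝ) γ, closedBall (t : ℂ) rE ⊆ O) ∧
        (∀ z ∈ O, ‖Ec z‖ ≤ E₀ * Real.exp (-(κ * (domSys (F.P K) M (k + 1)).dj X))) ∧
        (∀ t ∈ Ioc (0 : ℝ) γ, Ec t = (S k).E (Function.update p i t) φ X) := by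
  intro p hp X φ hφ
  -- extend the prefix to a window history by its own `0`-th coupling
  obtain ⟨g, hg⟩ : ∃ g : ℕ → ℝ, g = fun n => if h : n < k + 1 then p ⟨n, h⟩ else p 0 := ⟨_, rfl⟩
  have hgn : ∀ n (hn : n < k + 1), g n = p ⟨n, hn⟩ := fun n hn => by rw [hg]; exact dif_pos hn
  have hres : restrictPrefix k g = p := funext fun j => by rw [restrictPrefix_apply, hgn j j.2]
  have hgW : g ∈ Window γ := by
    intro n
    by_cases hn : n < k + 1
    · rw [hgn n hn]; exact hp ⟨n, hn⟩
    · have e : g n = p 0 := by rw [hg]; exact dif_neg hn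
      rw [e]; exact hp 0
  have hall := stripBound_termC_of_termwise226OnOlder_eHoloAt F K Sg Rz logZ β S c hL hLc hN hrE hA0 hr₁ hκ hrate hsmall hrenew hγ hκc
    h226TOnOlder hE (k + 1) g hgW i X φ hφ
  obtain ⟨Ec, O, -, hdisc, hhol, hbd, hrep⟩ := hall
  refine ⟨Ec, O, hhol, hdisc, hbd, fun t ht => ?_⟩
  rw [hrep t ht, termC_succ, restrictPrefix_update, hres]

end Step

/-! ## §2 ★★★ The (β′) letter from the per-step schemas, by J34 -/

section Letter

variable (F : T4Family) {𝔄 : Type*} [NormedRing 𝔄] [NormedAlgebra ℝ 𝔄] {V : Type*} [NormedAddCommGroup V] [NormedSpace ℝ V]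
  {ι' : Type*} [Fintype ι'] {𝔸 : Type*} [NormedRing 𝔸] [NormedAlgebra ℂ 𝔸] [CompleteSpace 𝔸] {G : Type*} [GaugeGroup G] {M : ℕ}

open Classical in
/-- ★★★ **THE (β′) LETTER FROM THE PER-STEP SCHEMAS (end-to-end analytic road in kernel currency).**  For node00-def-W1's term family `localizedSum F S emb` at the space tables of
record `U^c_{k+1}(X, cs.α₀, cs.α₁)` of the tori's settings `(Sg K, Rz K)`, a window `W ⊆ Window γ` (`γ ≤ cs.γ`), cube side `M = L_F^{m′}`: IF per torus `K` node N10's older-coupling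
level-T hypothesis `h226TOnOlder` holds UNIVERSALLY IN THE DOMAIN ([II] (2.14)–(2.26) on a common complex domain of one older coupling — DISPLAYED), node N09 supplies one
`EHoloAt (sfTowerOfRecord (Sg K) (Rz K) M (S K) ⟨g, β K⟩ (logZ K)) cs k` per window history and step with uniform letters `(E₀, r_E > 0)` (DISPLAYED), with the socket numerals
`Lemma3Numerics c M (½L) …`, `8 ≤ c.L`, S25's clauses at `A := C₃ε₁` (`κ ≤ r₁`, `r₁ + 128 log 162 + 2 ≤ (1−8δ)½L c.κ`, `C₃ε₁e^{5r₁+1}K₀(64,8)·9·64 ≤ 1`), the renewal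
`e·9·64·K₀(64,8)²C₃ε₁ ≤ E₀`, `κ ≤ cs.κ`; IF per `(K, k, X)` the complexified probe reading `Φ K k X` (open `U ⊇ ball 0 r`) extends the exponential chart's reading, maps the ball
into `U^c_{k+1}(X)` and makes the TERM `z ↦ E^{(k+1)}(X; histPrefix g k; Φ K k X z)` holomorphic; IF the site weights carry the tails `w ≤ B₃e^{−δ₀ distCT(·,X)}`, `δ₀ > 0`, and
`2κ₀(64,8) ≤ κ_w ≤ κ`: THEN `WindowedNE9 F (localizedSum F S emb) ρ bV W δ₁ (C·4E₀∕r_E)`, `C = (16B₃²∕r²)e^{12Mδ₁}K₀(64,8)K₁(4,δ₀∕2)`, `δ₁ = ½min{δ₀, κ_w(4M)⁻¹}` — §1 into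
J34's `windowedNE9_localizedSum_of_outputCoordHolo`. [cite: Balaban1988RG2Cluster, (2.13)-(2.26) pp.14-17, Lemma 3 (2.38) p.20 and (2.39)-(2.41) p.21; Balaban1987RG1, §1 p.263, §2 p.266, (1.7) p.261, (1.18), (1.20)-(1.21) p.264 and (5.10) p.293] -/
theorem windowedNE9_localizedSum_of_stripSchemas (m' : ℕ) (M : ℕ) [NeZero M] (hM : M = F.L ^ m')
    (S : (K : ℕ) → ClusterTower (F.P K) 𝔸 M) (emb : ReadingMaps F 𝔄 𝔸) (ρ : V →L[ℝ] 𝔄) (bV : Module.Basis ι' ℝ V)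
    (Sg : (K : ℕ) → Setting 𝔸 G) (Rz : (K : ℕ) → Residual (F.P K) 𝔸) (logZ : (K : ℕ) → ℕ → GaugeField (F.P K) 0 G → ℝ) (β : ℕ → ℕ → ℝ → ℝ)
    (c : B13.Consts) {L : ℕ} [NeZero L] (hL : 8 ≤ c.L) (hLc : c.L = L) {a a₂ a₂' a₅ Aabs : ℝ} (hN : Lemma3Numerics c M ((c.L : ℝ) / 2) a a₂ a₂' a₅ Aabs)
    (cs : SFConsts) {γ : ℝ} (W : Set (ℕ → ℝ)) (hWγ : W ⊆ Window γ) (hγ : γ ≤ cs.γ)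
    {rE E₀ κ r₁ κw δ₀ B₃ r : ℝ} (hrE : 0 < rE) (hA0 : 0 ≤ c.C3act * c.ε₁) (hr₁ : 0 ≤ r₁) (hκ : κ ≤ r₁)
    (hrate : r₁ + 2 * (64 * Real.log 162) + 2 ≤ (1 - 8 * c.δ) * ((c.L : ℝ) / 2) * c.κ)
    (hsmall : c.C3act * c.ε₁ * Real.exp (5 * r₁ + 1) * K₀ 64 8 * 9 * 64 ≤ 1)
    (hrenew : Real.exp 1 * 9 * 64 * K₀ 64 8 ^ 2 * (c.C3act * c.ε₁) ≤ E₀) (hκc : κ ≤ cs.κ)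
    (hκ₀ : kappa₀ (4 * 2 ^ 4) (2 * 4) ≤ κw / 2) (hκw : κw ≤ κ) (hδ₀ : 0 < δ₀) (hB₃ : 0 ≤ B₃) (hr : 0 < r)
    (h226TOnOlder : ∀ K : ℕ, 
      ∀ (D : Set ℂ), IsOpen D → (∀ t ∈ Ioc (0 : ℝ) γ, closedBall (t : ℂ) rE ⊆ D) →
        ∀ (k : ℕ) (g : ℕ → ℝ), g ∈ Window γ → ∀ (i : ℕ), i < k → ∀ (X : (domSys (F.P K) M (k + 1)).Dom) (φ : CPair (F.P K) 𝔸),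
        φ ∈ spaceI (Sg K) (Rz K) M (k + 1) (domSites (F.P K) M (k + 1) X) cs.α₀ cs.α₁ →
        (∀ (j : ℕ), j < k + 1 → ∀ (Y : (domSys (F.P K) M j).Dom) (ψ : CPair (F.P K) 𝔸), ψ ∈ spaceI (Sg K) (Rz K) M j (domSites (F.P K) M j Y) cs.α₀ cs.α₁ →
          ∃ Ec : ℂ → ℂ, DifferentiableOn ℂ Ec D ∧ (∀ z ∈ D, ‖Ec z‖ ≤ E₀ * Real.exp (-(κ * torusTreeLen Y.1))) ∧
            (∀ t ∈ Ioc (0 : ℝ) γ, Ec t = termC (S K) j Y (Function.update g i t) ψ)) →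
        ∃ (Hc : ℂ → TDom 4 (domCount (F.P K) M (k + 1)) → ℂ)
          (Tt : (Z : TDom 4 (domCount (F.P K) M (k + 1))) →
            Finset (TDom 4 (L * domCount (F.P K) M (k + 1))) × Finset (TBond 4 M (L * domCount (F.P K) M (k + 1))) → ℂ → ℂ),
          (∀ Z : (domSys (F.P K) M (k + 1)).Dom, Z.1 ⊆ X.1 → DifferentiableOn ℂ (fun z => Hc z Z) D) ∧
          (∀ z ∈ D, ∀ Z : TDom 4 (domCount (F.P K) M (k + 1)), Z.1 ⊆ X.1 → ‖Hc z Z‖ ≤ ∑ t ∈ terms L M Z, ‖Tt Z t z‖) ∧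
          (∀ z ∈ D, ∀ Z : TDom 4 (domCount (F.P K) M (k + 1)), Z.1 ⊆ X.1 → ∀ t ∈ terms L M Z,
            ‖Tt Z t z‖ ≤ weight L M c Z a t * Real.exp (a₅ * ((Z.1).card : ℝ))) ∧
          (∀ t ∈ Ioc (0 : ℝ) γ, Hc t = ((S K) k).H (restrictPrefix k (Function.update g i t)) φ))
    (hE : ∀ (K : ℕ), ∀ g ∈ Window γ, ∀ k : ℕ, ∃ H : EHoloAt (sfTowerOfRecord (Sg K) (Rz K) M (S K) ⟨g, β K⟩ (logZ K)) cs k, H.E₀ ≤ E₀ ∧ rE ≤ H.r)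
    (Ec : ℕ → ℕ → Type*) [∀ K k, NormedAddCommGroup (Ec K k)] [∀ K k, NormedSpace ℂ (Ec K k)]
    (ι : (K k : ℕ) → (domSys (F.P K) M (k + 1)).Dom → ((Fin (F.P K).d → Site (F.P K) (k + 1) → V) →L[ℝ] Ec K k))
    (Φ : (K k : ℕ) → (domSys (F.P K) M (k + 1)).Dom → Ec K k → CPair (F.P K) 𝔸)
    (U : (K k : ℕ) → (domSys (F.P K) M (k + 1)).Dom → Set (Ec K k)) (hU : ∀ K k X, IsOpen (U K k X)) (hrU : ∀ K k X, ball (0 : Ec K k) r ⊆ U K k X)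
    (hEhol : ∀ g ∈ W, ∀ (K k : ℕ) (X : (domSys (F.P K) M (k + 1)).Dom),
      DifferentiableOn ℂ (fun z => ((S K) k).E (histPrefix g k) (Φ K k X z) X) (U K k X))
    (hΦemb : ∀ (K k : ℕ) (X : (domSys (F.P K) M (k + 1)).Dom) (B : Fin (F.P K).d → Site (F.P K) (k + 1) → V),
      Φ K k X (ι K k X B) = emb K k (fun l t => NormedSpace.exp (ρ (B l t))))
    (hΦsp : ∀ (K k : ℕ) (X : (domSys (F.P K) M (k + 1)).Dom), ∀ z ∈ ball (0 : Ec K k) r,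
      Φ K k X z ∈ spaceI (Sg K) (Rz K) M (k + 1) (domSites (F.P K) M (k + 1) X) cs.α₀ cs.α₁)
    (w : (K k : ℕ) → (domSys (F.P K) M (k + 1)).Dom → Site (F.P K) (k + 1) → ℝ) (hw₀ : ∀ K k X t, 0 ≤ w K k X t)
    (hw : ∀ (K k : ℕ) (X : (domSys (F.P K) M (k + 1)).Dom) (l : Fin (F.P K).d) (t : Site (F.P K) (k + 1)) (c : ι'),
      ‖ι K k X (Pi.single l (Pi.single t (bV c)))‖ ≤ w K k X t)
    (htail : ∀ (K k : ℕ) (X : (domSys (F.P K) M (k + 1)).Dom) (t : Site (F.P K) (k + 1)),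
      let e : Site (F.P K) (k + 1) → TPt 4 (domCount (F.P K) M (k + 1) * M) := fun x i => (ZMod.cast (x i) : ZMod (domCount (F.P K) M (k + 1) * M))
      w K k X t ≤ B₃ * Real.exp (-δ₀ * distCT (domCount (F.P K) M (k + 1)) M (e t) (nearT (M := M) (e t) X))) :
    WindowedNE9 F (localizedSum F S emb) ρ bV W (delta1 δ₀ κw ((M : ℝ) * 4))
      (fun _ _ => 16 * B₃ ^ 2 / r ^ 2 * Real.exp (delta1 δ₀ κw ((M : ℝ) * 4) * ((M : ℝ) * 4) * 3) * K₀ (4 * 2 ^ 4) (2 * 4) * K₁ 4 (δ₀ / 2) *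
        (4 * E₀ / rE)) := by
  have hK : 0 < K₀ 64 8 := K₀_pos 64 8
  have hE₀ : 0 ≤ E₀ := le_trans (by positivity) hrenew
  exact windowedNE9_localizedSum_of_outputCoordHolo F m' M hM S emb ρ bV W hWγ
    (fun K k X => spaceI (Sg K) (Rz K) M (k + 1) (domSites (F.P K) M (k + 1) X) cs.α₀ cs.α₁) (fun _ _ => rE) (fun _ _ => hrE)
    hκ₀ hδ₀ hB₃ hr hE₀ hκw
    (fun K k i => outputCoordHolo_of_stripSchemas F K (Sg K) (Rz K) (logZ K) (β K) (S K) c hL hLc hN hrE.le hA0 hr₁ hκ hrate hsmall hrenew hγ hκc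
      (h226TOnOlder K) (hE K) k i)
    Ec ι Φ U hU hrU hEhol hΦemb hΦsp w hw₀ hw htail

end Letter

/-! ## §3 (v1.1, append-only) The VALUE letter from the same per-step schemas: printed (1.18) `TermBound118` on the window, then J36 -/

open Literature.MathematicalPhysics.QuantumFieldTheory.Balaban1983to89.Node00.U3KernelLetters (WindowedDecay)
open YMDAG.N22.W1 (termBound118_of_stripBound)

section Value

variable (F : T4Family) (K : ℕ) {𝔸 : Type*} [NormedRing 𝔸] [NormedAlgebra ℂ 𝔸] [CompleteSpace 𝔸] {G : Type*} [GaugeGroup G] {M : ℕ}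
  (Sg : Setting 𝔸 G) (Rz : Residual (F.P K) 𝔸) (logZ : ℕ → GaugeField (F.P K) 0 G → ℝ) (β : ℕ → ℝ → ℝ)

open Classical in
/-- **PRINTED (1.18) ON THE WINDOW FROM THE PER-STEP SCHEMAS.**  Module 14′ §4's all-coupling term strips read at the real points: node00-def-W1's printed-type predicate
`TermBound118 S (Window γ) (U^c_·(·, cs.α₀, cs.α₁)) E₀ κ` ([I] (1.18) on the complex spaces) — this seat's g2 `termBound118_of_stripBound` ∘
`stripBound_termC_of_termwise226OnOlder_eHoloAt`, one application. [cite: Balaban1987RG1, (1.18) p.263; Balaban1988RG2Cluster, (2.14)-(2.26) pp.15-17 and (2.41) p.21] -/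
theorem termBound118_of_stripSchemas [NeZero M] (S : ClusterTower (F.P K) 𝔸 M) (c : B13.Consts) {L : ℕ} [NeZero L]
    (hL : 8 ≤ c.L) (hLc : c.L = L) {a a₂ a₂' a₅ Aabs : ℝ} (hN : Lemma3Numerics c M ((c.L : ℝ) / 2) a a₂ a₂' a₅ Aabs)
    {cs : SFConsts} {γ rE E₀ κ r₁ : ℝ} (hrE : 0 ≤ rE) (hA0 : 0 ≤ c.C3act * c.ε₁) (hr₁ : 0 ≤ r₁) (hκ : κ ≤ r₁)
    (hrate : r₁ + 2 * (64 * Real.log 162) + 2 ≤ (1 - 8 * c.δ) * ((c.L : ℝ) / 2) * c.κ)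
    (hsmall : c.C3act * c.ε₁ * Real.exp (5 * r₁ + 1) * K₀ 64 8 * 9 * 64 ≤ 1)
    (hrenew : Real.exp 1 * 9 * 64 * K₀ 64 8 ^ 2 * (c.C3act * c.ε₁) ≤ E₀) (hγ : γ ≤ cs.γ) (hκc : κ ≤ cs.κ)
    (h226TOnOlder : ∀ (D : Set ℂ), IsOpen D → (∀ t ∈ Ioc (0 : ℝ) γ, closedBall (t : ℂ) rE ⊆ D) →
      ∀ (k : ℕ) (g : ℕ → ℝ), g ∈ Window γ → ∀ (i : ℕ), i < k → ∀ (X : (domSys (F.P K) M (k + 1)).Dom) (φ : CPair (F.P K) 𝔸),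
      φ ∈ spaceI Sg Rz M (k + 1) (domSites (F.P K) M (k + 1) X) cs.α₀ cs.α₁ →
      (∀ (j : ℕ), j < k + 1 → ∀ (Y : (domSys (F.P K) M j).Dom) (ψ : CPair (F.P K) 𝔸), ψ ∈ spaceI Sg Rz M j (domSites (F.P K) M j Y) cs.α₀ cs.α₁ →
        ∃ Ec : ℂ → ℂ, DifferentiableOn ℂ Ec D ∧ (∀ z ∈ D, ‖Ec z‖ ≤ E₀ * Real.exp (-(κ * torusTreeLen Y.1))) ∧
          (∀ t ∈ Ioc (0 : ℝ) γ, Ec t = termC S j Y (Function.update g i t) ψ)) →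
      ∃ (Hc : ℂ → TDom 4 (domCount (F.P K) M (k + 1)) → ℂ)
        (Tt : (Z : TDom 4 (domCount (F.P K) M (k + 1))) →
          Finset (TDom 4 (L * domCount (F.P K) M (k + 1))) × Finset (TBond 4 M (L * domCount (F.P K) M (k + 1))) → ℂ → ℂ),
        (∀ Z : (domSys (F.P K) M (k + 1)).Dom, Z.1 ⊆ X.1 → DifferentiableOn ℂ (fun z => Hc z Z) D) ∧
        (∀ z ∈ D, ∀ Z : TDom 4 (domCount (F.P K) M (k + 1)), Z.1 ⊆ X.1 → ‖Hc z Z‖ ≤ ∑ t ∈ terms L M Z, ‖Tt Z t z‖) ∧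
        (∀ z ∈ D, ∀ Z : TDom 4 (domCount (F.P K) M (k + 1)), Z.1 ⊆ X.1 → ∀ t ∈ terms L M Z,
          ‖Tt Z t z‖ ≤ weight L M c Z a t * Real.exp (a₅ * ((Z.1).card : ℝ))) ∧
        (∀ t ∈ Ioc (0 : ℝ) γ, Hc t = (S k).H (restrictPrefix k (Function.update g i t)) φ))
    (hE : ∀ g ∈ Window γ, ∀ k : ℕ, ∃ H : EHoloAt (sfTowerOfRecord Sg Rz M S ⟨g, β⟩ logZ) cs k, H.E₀ ≤ E₀ ∧ rE ≤ H.r) :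
    TermBound118 S (Window γ) (fun j Y => spaceI Sg Rz M j (domSites (F.P K) M j Y) cs.α₀ cs.α₁) E₀ κ :=
  termBound118_of_stripBound S (fun j Y => spaceI Sg Rz M j (domSites (F.P K) M j Y) cs.α₀ cs.α₁) hrE
    (stripBound_termC_of_termwise226OnOlder_eHoloAt F K Sg Rz logZ β S c hL hLc hN hrE hA0 hr₁ hκ hrate hsmall hrenew hγ hκc h226TOnOlder hE)

end Value

section ValueLetter

variable (F : T4Family) {𝔄 : Type*} [NormedRing 𝔄] [NormedAlgebra ℝ 𝔄] {V : Type*} [NormedAddCommGroup V] [NormedSpace ℝ V]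
  {ι' : Type*} [Fintype ι'] {𝔸 : Type*} [NormedRing 𝔸] [NormedAlgebra ℂ 𝔸] [CompleteSpace 𝔸] {G : Type*} [GaugeGroup G] {M : ℕ}

open Classical in
/-- ★★★ **THE VALUE LETTER FROM THE PER-STEP SCHEMAS.**  J36's `windowedDecay_localizedSum_of_termBound118` with `TermBound118` DISCHARGED per torus by
`termBound118_of_stripSchemas`: for a window `W ⊆ Window γ`, the per-torus schemas `h226TOnOlder` (node N10's lane) + `EHoloAt` families (node N09) + socket numerals +
S25's clauses + renewal, term holomorphy through the readings, chart ∕ space clauses at `X`, tails, `δ₀ > 0`, `2κ₀(64,8) ≤ κ_w ≤ κ` ⟹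
`WindowedDecay F (localizedSum F S emb) ρ bV W μ ν δ₁`.  With §2 BOTH K3⁷ letters read from the per-step schemas.
[cite: Balaban1987RG1, (1.7) p.261, (1.18) p.263, (1.20)-(1.21) p.264 and (5.10) p.293; Balaban1988RG2Cluster, (2.13)-(2.26) pp.14-17 and (2.41) p.21] -/
theorem windowedDecay_localizedSum_of_stripSchemas (m' : ℕ) (M : ℕ) [NeZero M] (hM : M = F.L ^ m')
    (S : (K : ℕ) → ClusterTower (F.P K) 𝔸 M) (emb : ReadingMaps F 𝔄 𝔸) (ρ : V →L[ℝ] 𝔄) (bV : Module.Basis ι' ℝ V)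
    (Sg : (K : ℕ) → Setting 𝔸 G) (Rz : (K : ℕ) → Residual (F.P K) 𝔸) (logZ : (K : ℕ) → ℕ → GaugeField (F.P K) 0 G → ℝ) (β : ℕ → ℕ → ℝ → ℝ)
    (c : B13.Consts) {L : ℕ} [NeZero L] (hL : 8 ≤ c.L) (hLc : c.L = L) {a a₂ a₂' a₅ Aabs : ℝ} (hN : Lemma3Numerics c M ((c.L : ℝ) / 2) a a₂ a₂' a₅ Aabs)
    (cs : SFConsts) {γ : ℝ} (W : Set (ℕ → ℝ)) (hWγ : W ⊆ Window γ) (hγ : γ ≤ cs.γ)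
    {rE E₀ κ r₁ κw δ₀ B₃ r : ℝ} (hrE : 0 < rE) (hA0 : 0 ≤ c.C3act * c.ε₁) (hr₁ : 0 ≤ r₁) (hκ : κ ≤ r₁)
    (hrate : r₁ + 2 * (64 * Real.log 162) + 2 ≤ (1 - 8 * c.δ) * ((c.L : ℝ) / 2) * c.κ)
    (hsmall : c.C3act * c.ε₁ * Real.exp (5 * r₁ + 1) * K₀ 64 8 * 9 * 64 ≤ 1)
    (hrenew : Real.exp 1 * 9 * 64 * K₀ 64 8 ^ 2 * (c.C3act * c.ε₁) ≤ E₀) (hκc : κ ≤ cs.κ)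
    (hκ₀ : kappa₀ (4 * 2 ^ 4) (2 * 4) ≤ κw / 2) (hκw : κw ≤ κ) (hδ₀ : 0 < δ₀) (hB₃ : 0 ≤ B₃) (hr : 0 < r)
    (h226TOnOlder : ∀ K : ℕ, 
      ∀ (D : Set ℂ), IsOpen D → (∀ t ∈ Ioc (0 : ℝ) γ, closedBall (t : ℂ) rE ⊆ D) →
        ∀ (k : ℕ) (g : ℕ → ℝ), g ∈ Window γ → ∀ (i : ℕ), i < k → ∀ (X : (domSys (F.P K) M (k + 1)).Dom) (φ : CPair (F.P K) 𝔸),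
        φ ∈ spaceI (Sg K) (Rz K) M (k + 1) (domSites (F.P K) M (k + 1) X) cs.α₀ cs.α₁ →
        (∀ (j : ℕ), j < k + 1 → ∀ (Y : (domSys (F.P K) M j).Dom) (ψ : CPair (F.P K) 𝔸), ψ ∈ spaceI (Sg K) (Rz K) M j (domSites (F.P K) M j Y) cs.α₀ cs.α₁ →
          ∃ Ec : ℂ → ℂ, DifferentiableOn ℂ Ec D ∧ (∀ z ∈ D, ‖Ec z‖ ≤ E₀ * Real.exp (-(κ * torusTreeLen Y.1))) ∧
            (∀ t ∈ Ioc (0 : ℝ) γ, Ec t = termC (S K) j Y (Function.update g i t) ψ)) →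
        ∃ (Hc : ℂ → TDom 4 (domCount (F.P K) M (k + 1)) → ℂ)
          (Tt : (Z : TDom 4 (domCount (F.P K) M (k + 1))) →
            Finset (TDom 4 (L * domCount (F.P K) M (k + 1))) × Finset (TBond 4 M (L * domCount (F.P K) M (k + 1))) → ℂ → ℂ),
          (∀ Z : (domSys (F.P K) M (k + 1)).Dom, Z.1 ⊆ X.1 → DifferentiableOn ℂ (fun z => Hc z Z) D) ∧
          (∀ z ∈ D, ∀ Z : TDom 4 (domCount (F.P K) M (k + 1)), Z.1 ⊆ X.1 → ‖Hc z Z‖ ≤ ∑ t ∈ terms L M Z, ‖Tt Z t z‖) ∧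
          (∀ z ∈ D, ∀ Z : TDom 4 (domCount (F.P K) M (k + 1)), Z.1 ⊆ X.1 → ∀ t ∈ terms L M Z,
            ‖Tt Z t z‖ ≤ weight L M c Z a t * Real.exp (a₅ * ((Z.1).card : ℝ))) ∧
          (∀ t ∈ Ioc (0 : ℝ) γ, Hc t = ((S K) k).H (restrictPrefix k (Function.update g i t)) φ))
    (hE : ∀ (K : ℕ), ∀ g ∈ Window γ, ∀ k : ℕ, ∃ H : EHoloAt (sfTowerOfRecord (Sg K) (Rz K) M (S K) ⟨g, β K⟩ (logZ K)) cs k, H.E₀ ≤ E₀ ∧ rE ≤ H.r)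
    (Ec : ℕ → ℕ → Type*) [∀ K k, NormedAddCommGroup (Ec K k)] [∀ K k, NormedSpace ℂ (Ec K k)]
    (ι : (K k : ℕ) → (domSys (F.P K) M (k + 1)).Dom → ((Fin (F.P K).d → Site (F.P K) (k + 1) → V) →L[ℝ] Ec K k))
    (Φ : (K k : ℕ) → (domSys (F.P K) M (k + 1)).Dom → Ec K k → CPair (F.P K) 𝔸)
    (U : (K k : ℕ) → (domSys (F.P K) M (k + 1)).Dom → Set (Ec K k)) (hU : ∀ K k X, IsOpen (U K k X)) (hrU : ∀ K k X, ball (0 : Ec K k) r ⊆ U K k X)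
    (hEhol : ∀ g ∈ W, ∀ (K k : ℕ) (X : (domSys (F.P K) M (k + 1)).Dom),
      DifferentiableOn ℂ (fun z => ((S K) k).E (histPrefix g k) (Φ K k X z) X) (U K k X))
    (hΦemb : ∀ (K k : ℕ) (X : (domSys (F.P K) M (k + 1)).Dom) (Bp : Fin (F.P K).d → Site (F.P K) (k + 1) → V),
      Φ K k X (ι K k X Bp) = emb K k (fun l t => NormedSpace.exp (ρ (Bp l t))))
    (hΦsp : ∀ (K k : ℕ) (X : (domSys (F.P K) M (k + 1)).Dom), ∀ z ∈ ball (0 : Ec K k) r,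
      Φ K k X z ∈ spaceI (Sg K) (Rz K) M (k + 1) (domSites (F.P K) M (k + 1) X) cs.α₀ cs.α₁)
    (w : (K k : ℕ) → (domSys (F.P K) M (k + 1)).Dom → Site (F.P K) (k + 1) → ℝ) (hw₀ : ∀ K k X t, 0 ≤ w K k X t)
    (hw : ∀ (K k : ℕ) (X : (domSys (F.P K) M (k + 1)).Dom) (l : Fin (F.P K).d) (t : Site (F.P K) (k + 1)) (c : ι'),
      ‖ι K k X (Pi.single l (Pi.single t (bV c)))‖ ≤ w K k X t)
    (htail : ∀ (K k : ℕ) (X : (domSys (F.P K) M (k + 1)).Dom) (t : Site (F.P K) (k + 1)),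
      let e : Site (F.P K) (k + 1) → TPt 4 (domCount (F.P K) M (k + 1) * M) := fun x i => (ZMod.cast (x i) : ZMod (domCount (F.P K) M (k + 1) * M))
      w K k X t ≤ B₃ * Real.exp (-δ₀ * distCT (domCount (F.P K) M (k + 1)) M (e t) (nearT (M := M) (e t) X)))
    (μ ν : Fin 4) :
    WindowedDecay F (localizedSum F S emb) ρ bV W μ ν (delta1 δ₀ κw ((M : ℝ) * 4)) := by
  have hK : 0 < K₀ 64 8 := K₀_pos 64 8
  have hE₀ : 0 ≤ E₀ := le_trans (by positivity) hrenew
  have hT : ∀ K : ℕ, TermBound118 (S K) W (fun j Y => spaceI (Sg K) (Rz K) M j (domSites (F.P K) M j Y) cs.α₀ cs.α₁) E₀ κ :=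
    fun K g hg => termBound118_of_stripSchemas F K (Sg K) (Rz K) (logZ K) (β K) (S K) c hL hLc hN hrE.le hA0 hr₁ hκ hrate hsmall hrenew hγ hκc
      (h226TOnOlder K) (hE K) g (hWγ hg)
  exact windowedDecay_localizedSum_of_termBound118 F m' M hM S emb ρ bV W
    (fun K j Y => spaceI (Sg K) (Rz K) M j (domSites (F.P K) M j Y) cs.α₀ cs.α₁) hκ₀ hδ₀ hB₃ hr hE₀ hκw hT
    Ec ι Φ U hU hrU hEhol hΦemb hΦsp w hw₀ hw htail μ ν

end ValueLetter

end YMDAG.N22.OutputLevel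

end
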